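import Summits.BirchSwinnertonDyer.Rank1Residual.GaloisImage.SakamotoRankOneAtOne
import Summits.BirchSwinnertonDyer.Rank1Residual.GaloisImage.SakamotoN11InstanceResidual
import HarnessLib

/-!
# Sakamoto 2024 Thm. 4.4 (1) at `m = 1` on `(E[3], 𝓕̄_can)` from surj(3) alone — UNCONDITIONALLY
# (the `hS24` binder of `SakamotoN11InstanceResidual` DISCHARGED by FILE F `SakamotoRankOneAtOne`)
# (cell `b2b-bsdres`, team n1011, row R1-59 (r1 §36.3; lead R5-70 ADD 3); seat p16 (gen 7) — FILE F's
# first consumer)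

HONEST FRAMING (cell `b2b-bsdres`, run/shared/lean/b2b/bsd-rank1-residual/, verbatim in every
file): the goal of the cell is to DELETE the COMBINATION-SHAPED residual classes of the
Birch–Swinnerton-Dyer formula for ALL analytic-rank `≤ 1` elliptic curves over `ℚ` — "full BSD
formula for every rank `≤ 1` curve in class `C`" assembled STRICTLY from published theorems — so
that the rank-`≤ 1` remainder becomes exactly the CONSTRUCTION-SHAPED classes, which are TYPED
(missing-input `Prop`s), NOT attempted. This is not "finishing BSD". Team n1011 (N10/N11): research
route on the CONSTRUCTION-SHAPED class X4 / §I N11; prove what is provable now; no claim beyond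
stated classes; census output = EVIDENCE, never a Literature fact; RESIDUAL-MAP marks UNCHANGED;
nothing is booked by this file. TOOL theorem only: NO definition, NO named fact, NO `_holds`.

## What

p13's `kolyvaginSystems_freeRankOne_propagatedSelmerStructureOne_of_surj`
(`GaloisImage/SakamotoN11InstanceResidual.lean`) instantiates the pinned fact [S24] Thm. 4.4 (1)
(`Sakamoto2024.kolyvaginSystems_freeRankOne_zmod_three_pow`, all `m`) at `m = 1` on
`(T, T̄) = (E[3], E[3])` with the identity residual pair and `𝓕 = 𝓕̄_can = propagatedSelmerStructureOne W 3`,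
discharging every hypothesis of the fact from surj(3) and the structural data — CONDITIONALLY on the
binder `hS24` (the fact itself). p13's FILE F `GaloisImage.kolyvaginSystems_freeRankOne_zmod_three_pow_at_one`
(`SakamotoRankOneAtOne.lean`, p292705) PROVES the `m = 1` slice
`Sakamoto2024.kolyvaginSystems_freeRankOne_zmod_three_pow_at 1` of that fact in the kernel. This file
is FILE F's first consumer: the SAME theorem with `hS24` DELETED —
**`kolyvaginSystems_freeRankOne_propagatedSelmerStructureOne_of_surj_atOne`**: for EVERY `E/ℚ` with
`ρ̄_{E,3}` onto, `KS₁(E[3], 𝓕̄_can, 𝒫(τ))` is free of rank one over `𝔽₃` and `κ ↦ κ_d` is a bijection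
onto `H¹_{𝓕̄_can(d)}(ℚ, E[3])` at every level `d` with `λ*(d) = 0` — the class-level UNCONDITIONAL
`m = 1` structure theorem of ROUTE-1 (r1 §36.3). Proof = p13's proof verbatim with l.272's `hS24 … 1 …`
replaced by the slice theorem (binders of the slice = binders of the fact minus `m`). The old
conditional theorem follows from the new one trivially and is kept (other files import it).

HONEST LIMIT: `m = 1` only (the `∀ m` fact stays a named fact; `m ≥ 2` is [MR04]'s principal
artinian theory, not held); no (a′)/E2 debt retired; no class theorem on the RESIDUAL-MAP, no BSD
statement; census −0; nothing booked.

References: R. Sakamoto, J. Théor. Nombres Bordeaux 36 (2024) §2 (H.1)–(H.3), Def. 3.5–3.8,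
Thm. 4.4 (1) [Sakamoto2024]; B. Mazur, K. Rubin, Mem. AMS 799 (2004) §3.5 [MazurRubin2004];
K. Rubin, *Euler systems and Kolyvagin systems* (PCMI 2009/AMS 2011) Cor. 2.8.9 [Rubin2011];
cells/n1011/ROUTE-1.md §36.3 (R1-59); cells/n1011/skel/T-R1-56-S.md §R1-59.
-/

noncomputable section

open scoped Classical NumberField ContRepresentation
open Field NumberField IsDedekindDomain
open WeierstrassCurve Literature.NumberTheory.EllipticCurves Literature.NumberTheory.GaloisRepresentations
  Literature.NumberTheory.GaloisRepresentations.DiscreteGaloisModule Literature.NumberTheory.GaloisCohomology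

universe u

namespace Summit.BirchSwinnertonDyer.Rank1Residual.GaloisImage

variable (W : WeierstrassCurve ℚ) [W.IsElliptic]

/-- **Sakamoto's Thm. 4.4 (1) at `m = 1` directly on `(E[3], 𝓕̄_can)`, from surj(3) ALONE —
UNCONDITIONAL** (p13's `kolyvaginSystems_freeRankOne_propagatedSelmerStructureOne_of_surj` with the
fact-binder `hS24` DISCHARGED by FILE F `kolyvaginSystems_freeRankOne_zmod_three_pow_at_one`).
`T = T̄ = E[3]` (`W.torsionGaloisModule 3`), residual pair = the identities (legitimate at `m = 1`:
`red` onto, `ker red = 0 = 3·E[3]`, `incl ∘ red = 3⁰`), `𝓕 = 𝓕̄_can = propagatedSelmerStructureOne W 3`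
(Mazur–Rubin's structure propagated from `T₃E`, read on `E[3]`). DISCHARGED (as in p13's theorem):
(H.1) from surj(3); (H.3) at `m = 1` by n1011-p04's `hH3_self_of_hasSurjectiveModNGaloisRep` (no
tower); (H.SD) and the residual coisotropy by the Weil choice of `θ` (n1011-p18); cartesian (trivial
for the identity pair); `hS'`/`hunr` for `S ⊇ ∞ ∪ {3} ∪ {bad}`; the CORE RANK `χ(𝓕̄_can) = 1` by
p13's `hasCoreRank_one_propagatedSelmerStructureOne` with `hbd` (p05), `hKfin` (Silverman X.4.2 (b)),
`hKSD` (p13) and (Lp) `hLpIm` (n1011-p04 T-Lp, from `hEP`); AND NOW the fact itself at `m = 1` by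
FILE F (p13, p292705). CONCLUSION: `KS₁(E[3], 𝓕̄_can, 𝒫(τ))` is free of rank one over `𝔽₃`, and
`κ ↦ κ_d` is a bijection onto `H¹_{𝓕̄_can(d)}(ℚ, E[3])` at every level `d` with `λ*(d) = 0` (`λ*` for
the residual family `inv`). Binders (nothing hidden): `[Finite E[3]]`, surj(3), the `τ`-datum
(`τ ∈ Γ_{ℚ(μ₃)}`, `E[3]/(τ−1) ≃ ℤ/3` — exists by p260356
`exists_rootsOfUnityFixer_cokerSubOne_equiv_zmod_three_of_surj`), the Poitou–Tate family `inv` ×4,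
`hEP`, an admissible `S`, the Kolyvagin datum on `E[3]` (`D`, `η`, `hP`, `hT`, `hD`). NO `hS24`. No
tower: every surj(3) row incl. EXOTIC. `m = 1` only; nothing booked; no mark changed.
[cite: Sakamoto2024, §2 (H.1)–(H.3) (p. 921), Def. 3.5–3.8 (pp. 923–924), Thm. 4.4 (1) (p. 926)]
[cite: Rubin2011, Cor. 2.8.9 (2) (p. 25)] -/
theorem kolyvaginSystems_freeRankOne_propagatedSelmerStructureOne_of_surj_atOne
    [Finite (geomTorsion W ((3 : ℕ) : ℤ))]
    (h3 : W.HasSurjectiveModNGaloisRep ((3 : ℕ) : ℤ))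
    (τ : absoluteGaloisGroup ℚ) (hτμ : τ ∈ rootsOfUnityFixer ℚ 3)
    (hτq : Nonempty (cokerSubOne (W.torsionGaloisModule ((3 : ℕ) : ℤ)) τ ≃+ ZMod 3))
    (inv : LocalInvariants ℚ 3) (hperf : inv.IsPerfect) (hsum : inv.SumLocalTermEqZero)
    (hunro : inv.UnramifiedOrthogonal) (hcompl : inv.SelmerComplement)
    (hEP : ∀ v : HeightOneSpectrum (𝓞 ℚ), localEulerPoincareCharacteristic (v.adicCompletion ℚ))
    (S : Finset (Place ℚ)) (hS : ∀ w : InfinitePlace ℚ, (Sum.inl w : Place ℚ) ∈ S)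
    (h3S : ∀ v : HeightOneSpectrum (𝓞 ℚ), ((3 : ℕ) : 𝓞 ℚ) ∈ v.asIdeal → (Sum.inr v : Place ℚ) ∈ S)
    (hbadS : ∀ v : HeightOneSpectrum (𝓞 ℚ), ¬ W.HasGoodReductionAt v → (Sum.inr v : Place ℚ) ∈ S)
    (D : KolyvaginDatum (W.torsionGaloisModule ((3 : ℕ) : ℤ)))
    (η : (q : HeightOneSpectrum (𝓞 ℚ)) → (ZMod (Ideal.absNorm q.asIdeal))ˣ)
    (hP : D.primes = frobeniusClassPrimes (W.torsionGaloisModule ((3 : ℕ) : ℤ))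
      {v | (Sum.inr v : Place ℚ) ∈ S} τ 3)
    (hT : D.transverse = cyclotomicTransverse (W.torsionGaloisModule ((3 : ℕ) : ℤ)))
    (hD : D.HasCanonicalComparison 3 η) :
    KolyvaginSystem.IsFreeRankOneZMod (D.kolyvaginSystems (propagatedSelmerStructureOne W 3)) 3 ∧
      ∀ (d : Finset (HeightOneSpectrum (𝓞 ℚ))) (hd : D.IsLevel d),
        LocalInvariants.lambdaStar inv (D.atLevel (propagatedSelmerStructureOne W 3) d) 3 = 0 →
        Function.Bijective fun κ : D.kolyvaginSystems (propagatedSelmerStructureOne W 3) =>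
          (⟨κ.1 d, ((KolyvaginDatum.mem_kolyvaginSystems_iff D _ κ.1).mp κ.2).mem_selmerGroup
              d hd⟩ : (D.atLevel (propagatedSelmerStructureOne W 3) d).selmerGroup) := by
  -- p13's proof of `kolyvaginSystems_freeRankOne_propagatedSelmerStructureOne_of_surj`, verbatim, with
  -- the fact `hS24 … 1 …` replaced by FILE F's slice theorem at `m = 1`
  haveI : Fact (Nat.Prime 3) := ⟨Nat.prime_three⟩
  haveI : NeZero ((3 : ℕ) : ℚ) := ⟨by norm_num⟩
  -- the `ℤ/3^1`-module `E[3]` (any structure is admissible: the slice quantifies over it)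
  haveI hF : Fact (Nat.Prime (3 ^ 1)) := ⟨by norm_num⟩
  letI : Module (ZMod (3 ^ 1)) (geomTorsion W ((3 : ℕ) : ℤ)) :=
    (inferInstance : Module (ZMod 3) (geomTorsion W ((3 : ℕ) : ℤ)))
  haveI : Module.Finite (ZMod (3 ^ 1)) (geomTorsion W ((3 : ℕ) : ℤ)) := Module.Finite.of_finite
  -- the Weil datum, the `3`-descent finiteness / self-duality count, the core rank
  obtain ⟨e, hμ, hadd₁, hadd₂, halt, hnondeg, hgal⟩ :=
    exists_weilPairing_holds W 3 (by norm_num) (by norm_num)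
  let T : Finset (HeightOneSpectrum (𝓞 ℚ)) := S.preimage Sum.inr Sum.inr_injective.injOn
  have h3T : ∀ v : HeightOneSpectrum (𝓞 ℚ), ((3 : ℕ) : 𝓞 ℚ) ∈ v.asIdeal → v ∈ T :=
    fun v hv => Finset.mem_preimage.mpr (h3S v hv)
  have hbadT : ∀ v : HeightOneSpectrum (𝓞 ℚ), ¬ W.HasGoodReductionAt v → v ∈ T :=
    fun v hv => Finset.mem_preimage.mpr (hbadS v hv)
  have hKfin : Finite (W.kummerSelmerStructure ((3 : ℕ) : ℤ)).selmerGroup := by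
    rw [← selmerGroup_eq_selmerGroup_kummerSelmerStructure]
    exact W.finite_selmerGroup_holds (by norm_num)
  haveI := hKfin
  have hKSD := natCard_selmerGroup_kummer_eq_dual W 3 e hμ hadd₁ hadd₂ hgal halt hnondeg
    Nat.prime_three.isPrimePow (by decide) inv (fun v => (hperf v).1.injective) hEP
  have hCR : LocalInvariants.HasCoreRank inv (propagatedSelmerStructureOne W 3) 3 1 :=
    hasCoreRank_one_propagatedSelmerStructureOne W inv hperf hsum hcompl T h3T hbadT
      (fun v hv => bounded_pPrimaryTorsion_localGaloisModule_rat W 3 hv) hKfin hKSD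
      (fun v hv => natCard_propagatedSelmerStructureOne_three W v (hEP v) hv)
  have hco := isResiduallyCoisotropic_propagatedSelmerStructureOne_three W e hμ hadd₁ hadd₂ hgal
    halt hnondeg inv hperf S (fun v _ => hEP v)
  -- FILE F: the fact at `m = 1`, `T = T̄ = E[3]`, identity residual pair
  have h := kolyvaginSystems_freeRankOne_zmod_three_pow_at_one
    (geomTorsion W ((3 : ℕ) : ℤ)) (geomTorsion W ((3 : ℕ) : ℤ))
    (W.torsionGaloisModule _) (W.torsionGaloisModule _) ContIntertwiningMap.id ContIntertwiningMap.id
    τ (weilDualIntertwining W 3 e hμ hadd₁ hadd₂ hgal) inv S (propagatedSelmerStructureOne W 3) D η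
    (fun x => ⟨x, rfl⟩) (id_eq_zero_iff_exists W) (id_id_eq_pow_smul W)
    (residual_irreducible_of_surj W 3 h3) (by simpa using hτμ) (by simpa using hτq)
    (fun f hf => hH3_self_of_hasSurjectiveModNGaloisRep W 3 (by decide) h3 f
      (fun u hu hμu => hf u hu (by simpa using hμu)))
    (X11b.LocBridge.weilDualHom_bijective W 3 e hμ hadd₁ hadd₂ hnondeg)
    hperf hsum hunro hcompl hS (fun v hv => not_mem_and_isUnramifiedAt_three_of_not_mem W S h3S hbadS hv)
    (propagatedSelmerStructureOne_three_isUnramifiedOutside W S hS h3S hbadS)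
    (IdPair.isCartesian_id _ S) (by rw [IdPair.induced_id]; exact hCR)
    (by rw [IdPair.induced_id]; exact hco) (by simpa using hP) hT (by simpa using hD)
  refine ⟨by simpa using h.1, fun d hd hlam => h.2 d hd ?_⟩
  rwa [IdPair.induced_id]

end Summit.BirchSwinnertonDyer.Rank1Residual.GaloisImage

end
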